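import Summits.CriticalPhenomena.Ising3DConformalLimit.Theorems.MonotoneBlockingMonotoneBlockingTwoKarlinDefs
import HarnessLib

/-!
# Stub `fourFunctions` of line `Sketch` (karlin-scale-tp2) for crux `MonotoneBlockingTwo` (stmt-CriticalPhenomena-17054): the continuous four-functions theorem on a chain

For an arbitrary measure `μ` on `ℝ` (the registered statement carries an `SFinite μ` instance, which the
proof does not use), a measurable set `S ⊆ ℝ` and measurable `f₁ f₂ f₃ f₄ : ℝ → ℝ≥0∞` with
`f₁ t · f₂ t' ≤ f₃ (t ∨ t') · f₄ (t ∧ t')` on `S × S`, we prove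
`∫_S f₁ · ∫_S f₂ ≤ ∫_S f₃ · ∫_S f₄` (Ahlswede–Daykin on a chain; Karlin–Rinott 1980, Thm 2.1 with `n = 1`).

Proof: the hypothesis at the four pairs `(t,t'), (t',t), (t,t), (t',t')` and the elementary inequality
`a, b ≤ X → a b ≤ X Y → a + b ≤ X + Y` in `ℝ≥0∞` give the POINTWISE symmetrised inequality
`f₁ t f₂ t' + f₂ t f₁ t' ≤ f₃ t f₄ t' + f₄ t f₃ t'` on `S × S`; integrating it in `t'` and then in `t`
(iterated one-dimensional Lebesgue integrals, no product measure) gives twice the claim.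
-/

noncomputable section

namespace Summit.CriticalPhenomena.Ising3DConformalLimit.Cruxes.MonotoneBlockingTwo.KarlinScaleTP2

open MeasureTheory Set
open scoped BigOperators ENNReal NNReal

/-- The elementary engine of the four-functions theorem on a two-point chain, real version:
if `a, b ≤ X`, `0 ≤ Y` and `a b ≤ X Y` then `a + b ≤ X + Y`. -/
theorem fourFunctions_real_add_le {a b X Y : ℝ} (hY₀ : 0 ≤ Y)
    (ha : a ≤ X) (hb : b ≤ X) (hab : a * b ≤ X * Y) : a + b ≤ X + Y := by
  by_contra hlt
  rw [not_le] at hlt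
  have h1 : Y < a := by linarith
  have h2 : Y < b := by linarith
  nlinarith [mul_pos (sub_pos.2 h1) (sub_pos.2 h2), mul_nonneg hY₀ (sub_pos.2 hlt).le]

/-- The elementary engine of the four-functions theorem on a two-point chain, in `ℝ≥0∞`:
if `a, b ≤ X` and `a b ≤ X Y` then `a + b ≤ X + Y`. -/
theorem fourFunctions_ennreal_add_le {a b X Y : ℝ≥0∞} (ha : a ≤ X) (hb : b ≤ X)
    (hab : a * b ≤ X * Y) : a + b ≤ X + Y := by
  rcases eq_or_ne X ∞ with rfl | hX
  · simp
  rcases eq_or_ne Y ∞ with rfl | hY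
  · simp
  have ha' : a ≠ ∞ := ne_top_of_le_ne_top hX ha
  have hb' : b ≠ ∞ := ne_top_of_le_ne_top hX hb
  lift X to ℝ≥0 using hX
  lift Y to ℝ≥0 using hY
  lift a to ℝ≥0 using ha'
  lift b to ℝ≥0 using hb'
  have ha1 : (a : ℝ) ≤ X := by exact_mod_cast ha
  have hb1 : (b : ℝ) ≤ X := by exact_mod_cast hb
  have hab1 : (a : ℝ) * b ≤ X * Y := by exact_mod_cast hab
  have key : (a : ℝ) + b ≤ X + Y :=
    fourFunctions_real_add_le Y.coe_nonneg ha1 hb1 hab1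
  exact_mod_cast key

/-- The pointwise (symmetrised) four-functions inequality on a chain: if
`f₁ t f₂ t' ≤ f₃ (t ∨ t') f₄ (t ∧ t')` on `S × S` then for `x, y ∈ S`,
`f₁ x f₂ y + f₂ x f₁ y ≤ f₃ x f₄ y + f₄ x f₃ y`. -/
theorem fourFunctions_pointwise {S : Set ℝ} {f₁ f₂ f₃ f₄ : ℝ → ℝ≥0∞}
    (h : ∀ t ∈ S, ∀ t' ∈ S, f₁ t * f₂ t' ≤ f₃ (max t t') * f₄ (min t t'))
    {x y : ℝ} (hx : x ∈ S) (hy : y ∈ S) :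
    f₁ x * f₂ y + f₂ x * f₁ y ≤ f₃ x * f₄ y + f₄ x * f₃ y := by
  have hxx := h x hx x hx
  have hyy := h y hy y hy
  have hxy := h x hx y hy
  have hyx := h y hy x hx
  simp only [max_self, min_self] at hxx hyy
  rcases le_total x y with hle | hle
  · rw [max_eq_right hle, min_eq_left hle] at hxy
    rw [max_eq_left hle, min_eq_right hle] at hyx
    -- `a := f₁ x f₂ y`, `b := f₂ x f₁ y`, `X := f₄ x f₃ y`, `Y := f₃ x f₄ y`
    have hA : f₁ x * f₂ y ≤ f₄ x * f₃ y := by rw [mul_comm (f₄ x)]; exact hxy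
    have hB : f₂ x * f₁ y ≤ f₄ x * f₃ y := by rw [mul_comm (f₂ x), mul_comm (f₄ x)]; exact hyx
    have hAB : f₁ x * f₂ y * (f₂ x * f₁ y) ≤ f₄ x * f₃ y * (f₃ x * f₄ y) := by
      calc f₁ x * f₂ y * (f₂ x * f₁ y) = f₁ x * f₂ x * (f₁ y * f₂ y) := by ring
        _ ≤ f₃ x * f₄ x * (f₃ y * f₄ y) := mul_le_mul' hxx hyy
        _ = f₄ x * f₃ y * (f₃ x * f₄ y) := by ring
    rw [add_comm (f₃ x * f₄ y)]
    exact fourFunctions_ennreal_add_le hA hB hAB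
  · rw [max_eq_left hle, min_eq_right hle] at hxy
    rw [max_eq_right hle, min_eq_left hle] at hyx
    -- `a := f₁ x f₂ y`, `b := f₂ x f₁ y`, `X := f₃ x f₄ y`, `Y := f₄ x f₃ y`
    have hB : f₂ x * f₁ y ≤ f₃ x * f₄ y := by rw [mul_comm (f₂ x)]; exact hyx
    have hAB : f₁ x * f₂ y * (f₂ x * f₁ y) ≤ f₃ x * f₄ y * (f₄ x * f₃ y) := by
      calc f₁ x * f₂ y * (f₂ x * f₁ y) = f₁ x * f₂ x * (f₁ y * f₂ y) := by ring
        _ ≤ f₃ x * f₄ x * (f₃ y * f₄ y) := mul_le_mul' hxx hyy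
        _ = f₃ x * f₄ y * (f₄ x * f₃ y) := by ring
    exact fourFunctions_ennreal_add_le hxy hB hAB

/-- **The continuous four-functions theorem on a chain** (stub `fourFunctions` of line `Sketch`): for a measure
`μ` on `ℝ`, a measurable `S ⊆ ℝ` and measurable `f₁ f₂ f₃ f₄ : ℝ → ℝ≥0∞` with
`f₁ t f₂ t' ≤ f₃ (t ∨ t') f₄ (t ∧ t')` on `S × S`, one has `∫_S f₁ · ∫_S f₂ ≤ ∫_S f₃ · ∫_S f₄`. -/
theorem stub_fourFunctions : Sig.stub_fourFunctions := by
  intro μ _ S hS f₁ f₂ f₃ f₄ hf₁ hf₂ hf₃ hf₄ h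
  -- names for the four set integrals
  set I₁ := ∫⁻ t in S, f₁ t ∂μ
  set I₂ := ∫⁻ t in S, f₂ t ∂μ
  set I₃ := ∫⁻ t in S, f₃ t ∂μ
  set I₄ := ∫⁻ t in S, f₄ t ∂μ
  -- Step A: integrate the pointwise inequality in the second variable.
  have stepA : ∀ x ∈ S, f₁ x * I₂ + f₂ x * I₁ ≤ f₃ x * I₄ + f₄ x * I₃ := by
    intro x hx
    have lhs : ∫⁻ y in S, (f₁ x * f₂ y + f₂ x * f₁ y) ∂μ = f₁ x * I₂ + f₂ x * I₁ := by
      rw [lintegral_add_left (hf₂.const_mul (f₁ x)), lintegral_const_mul _ hf₂,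
        lintegral_const_mul _ hf₁]
    have rhs : ∫⁻ y in S, (f₃ x * f₄ y + f₄ x * f₃ y) ∂μ = f₃ x * I₄ + f₄ x * I₃ := by
      rw [lintegral_add_left (hf₄.const_mul (f₃ x)), lintegral_const_mul _ hf₄,
        lintegral_const_mul _ hf₃]
    rw [← lhs, ← rhs]
    exact setLIntegral_mono' hS fun y hy => fourFunctions_pointwise h hx hy
  -- Step B: integrate Step A in the first variable.
  have stepB : I₁ * I₂ + I₂ * I₁ ≤ I₃ * I₄ + I₄ * I₃ := by
    have lhs : ∫⁻ x in S, (f₁ x * I₂ + f₂ x * I₁) ∂μ = I₁ * I₂ + I₂ * I₁ := by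
      rw [lintegral_add_left (hf₁.mul_const I₂), lintegral_mul_const _ hf₁,
        lintegral_mul_const _ hf₂]
    have rhs : ∫⁻ x in S, (f₃ x * I₄ + f₄ x * I₃) ∂μ = I₃ * I₄ + I₄ * I₃ := by
      rw [lintegral_add_left (hf₃.mul_const I₄), lintegral_mul_const _ hf₃,
        lintegral_mul_const _ hf₄]
    rw [← lhs, ← rhs]
    exact setLIntegral_mono' hS stepA
  -- Cancel the factor `2`.
  rw [mul_comm I₂ I₁, mul_comm I₄ I₃, ← two_mul, ← two_mul] at stepB
  exact (ENNReal.mul_le_mul_iff_right two_ne_zero ENNReal.ofNat_ne_top).1 stepB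

end Summit.CriticalPhenomena.Ising3DConformalLimit.Cruxes.MonotoneBlockingTwo.KarlinScaleTP2

end
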